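import Summits.QuantumFields.BalabanUV.T4Continuum.Support.NE7K1LinWalkLineHcomm

/-!
# NE7K1LinWalkLineCoarseSharp — row NE7 (node U5), candidate route HOM, path H1L, cell K1-lin(s): THE COARSE BLOCK'S FORM AGAINST THE
# LINE'S WITH THE MESH-SHARP CONSTANT `L` (was `L²`) — lens 2's located numbers (N-51-1) ∕ (N-52-1) IN KERNEL

Lineage `b2b-balaban-t4-ne7-p2` (CRUX PROVER NE7 #2), generation 70; series (RW) file 21, over file 13 `NE7K1LinWalkLineHcomm`.
Located numbers of the NE7 lens-2 seat (t4-ne7-idea-2 g51 ∕ g52, `HOME/INBOX.md` [NE7IDEA2-G51-INBOX] (N-51-1), [NE7IDEA2-G52-INBOX]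
(N-52-1), take-or-leave to this lineage): in file 13's `runB₁₁_form_le` — `s·⟨a,(H_B)₁₁a⟩ ≤ L²·⟨u,H_Bu⟩`, `u = (√s a, ψ∕n)` — the constant
`L²` (from the block-constant trial `NE7K1LinRunBScales.trial_form_le`) CAN BE `L`, by three names already in the tree:
`NE7K1LinWalkLineCoarse.runB_toBlocks₁₁_eq` (`(H_B)₁₁ = P_A + (L−1)·lap(adjC n)` as matrices), `NE7K1LinFineOpBilinWeight.dirichlet_le_fineOpR_form`
(`⟨v, lap(adjC n) v⟩ ≤ ⟨v, P_A v⟩`, `a ≥ 0`) and `NE7K1LinWalkLine.runB_form_ge_runA` (Jensen); and (N-52-1): `L` is MESH-SHARP for this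
route (`sup_n max_V ⟨V,(H_B)₁₁V⟩∕⟨V,S_BV⟩ = L` exactly, lens 2's exact computation `lens2-g52/copt_floor_d1_v2.py`).
* **`toBlocks₁₁_form_le_sharp`** — `⟨v,(H_B)₁₁v⟩ ≤ L·⟨v,P_Av⟩` for every `v` (`n ≥ 1`, `a > 0`, `R′` a union of `nL`-blocks);
* **`runB₁₁_form_le_sharp`** — `s·⟨a,(H_B)₁₁a⟩ ≤ L·⟨(√s a, ψ∕n), H_B(√s a, ψ∕n)⟩` for every `ψ`, `0 ≤ s`.
CONSEQUENCE OF RECORD (not re-derived through files 13–17, whose displayed constants stand): in file 13's `comm_extLine_sq_le` the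
coefficient `L²·12(d+1)Ln²ℓ₁²` of `α♮` may read `L·12(d+1)Ln²ℓ₁²`, i.e. file 14's `lineAlpha2 = 384(d+1)(1+L³)∕M²` may read
`384(d+1)(1+L²)∕M²`; no letter, no threshold statement and no theorem of files 14–20 depends on the improvement (the walk is s- and
mesh-uniform either way; `L` is a fixed `O(1)` blocking factor).
HONEST FRAMING: [folklore]; A = 0, U = 1; a located constant improvement of record, census only; nothing of Bałaban's asserted; no `sorry`.
NO letter ∕ tag ∕ size of NE7 moves; NE7 NOT PRINTED ∕ NOT PROVED; spine 0∕9; FIXED FINITE T⁴, rung (B)+1; NOT infinite volume, NOT mass gap,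
NOT Clay.  HONEST DEPENDENCY: continuum YM on T⁴ ⇐ BetaPertH ∧ nine spine estimates (0/9 proved); BetaPertH ⇐ (D1) ∧ (D4) ∧ CAP+tail;
G-an2-4 gates asym, D1 and NE2/3/4.
-/

noncomputable section

open Finset Matrix

namespace Summit.QuantumFields.BalabanUV.T4Continuum.NE7K1LinWalkLineCoarseSharp

open Literature.MathematicalPhysics.QuantumFieldTheory.Balaban1983to89
open Literature.MathematicalPhysics.QuantumFieldTheory.Balaban1983to89.B4Reflection242
open Literature.MathematicalPhysics.QuantumFieldTheory.Balaban1983to89.B4BoxCov237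
open Literature.MathematicalPhysics.QuantumFieldTheory.Balaban1983to89.B4Lower18
open Literature.MathematicalPhysics.QuantumFieldTheory.Balaban1983to89.Beta.CombesThomasForm (lap)
open NE7K1LinBlockCoords NE7K1LinSchurLineU1 NE7K1LinSchurLineU1Sharp NE7K1LinFineOpBilinWeight NE7K1LinWalkLine NE7K1LinWalkLineCoarse
  NE7K1LinWalkLineHcomm

variable {d : ℕ} {n L : ℕ} [NeZero L] {R' : Finset (Fin (d + 1) → ℤ)} (hn : 1 ≤ n) (hR' : IsBlockUnion (n * L) R') {a : ℝ} (ha : 0 < a)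
  {s : ℝ} (hs0 : 0 ≤ s)

include hn ha in
/-- **THE COARSE BLOCK OF RUN B AGAINST RUN A, CONSTANT `L`**: `⟨v,(H_B)₁₁v⟩ ≤ L·⟨v,P_Av⟩` — `(H_B)₁₁ = P_A + (L−1)·lap(adjC n)` and the
Dirichlet part of `P_A` dominates `lap(adjC n)`. (lens 2's (N-51-1); mesh-sharp by (N-52-1).) [folklore] -/
theorem toBlocks₁₁_form_le_sharp (v : ↥(R'.image (blk L)) → ℝ) :
    v ⬝ᵥ (runB (isBlockUnion_fine hR') n a).toBlocks₁₁ *ᵥ v ≤ (L : ℝ) * (v ⬝ᵥ (runA n L a R') *ᵥ v) := by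
  have hL : 1 ≤ L := NeZero.one_le
  have hL1 : (0 : ℝ) ≤ (L : ℝ) - 1 := by
    have : (1 : ℝ) ≤ L := by exact_mod_cast hL
    linarith
  rw [runB_toBlocks₁₁_eq hn hR' a, add_mulVec, dotProduct_add, smul_mulVec, dotProduct_smul, smul_eq_mul]
  have h1 : v ⬝ᵥ (lap (adjC n (R'.image (blk L)))) *ᵥ v ≤ v ⬝ᵥ (runA n L a R') *ᵥ v :=
    dirichlet_le_fineOpR_form hn (isBlockUnion_coarse hL hR') ha.le v
  have h2 := mul_le_mul_of_nonneg_left h1 hL1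
  linarith

include hn ha hs0 in
/-- **THE COARSE BLOCK'S FORM AGAINST THE LINE'S, CONSTANT `L`**: `s·⟨a,(H_B)₁₁a⟩ ≤ L·⟨(√s a, ψ∕n), H_B(√s a, ψ∕n)⟩` for every `ψ` — file 13's
`runB₁₁_form_le` with `L²` replaced by `L` (`toBlocks₁₁_form_le_sharp` + Jensen `NE7K1LinWalkLine.runB_form_ge_runA`). [folklore] -/
theorem runB₁₁_form_le_sharp (av : ↥(R'.image (blk L)) → ℝ) (ψ : ↥(R'.image (blk L)) × NZ d L → ℝ) :
    s * (av ⬝ᵥ (runB (isBlockUnion_fine hR') n a).toBlocks₁₁ *ᵥ av) ≤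
      (L : ℝ) * (Sum.elim (Real.sqrt s • av) ((1 / (n : ℝ)) • ψ) ⬝ᵥ
        (runB (isBlockUnion_fine hR') n a) *ᵥ (Sum.elim (Real.sqrt s • av) ((1 / (n : ℝ)) • ψ))) := by
  have hss : Real.sqrt s * Real.sqrt s = s := Real.mul_self_sqrt hs0
  have h1 := toBlocks₁₁_form_le_sharp hn hR' ha av
  have h2 := runB_form_ge_runA hn hR' ha (Real.sqrt s • av) ((1 / (n : ℝ)) • ψ)
  have h3 : (Real.sqrt s • av) ⬝ᵥ (runA n L a R').mulVec (Real.sqrt s • av) = s * (av ⬝ᵥ (runA n L a R') *ᵥ av) := by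
    rw [mulVec_smul, smul_dotProduct, dotProduct_smul, smul_eq_mul, smul_eq_mul, ← mul_assoc, hss]
  rw [h3] at h2
  have hL0 : (0 : ℝ) ≤ (L : ℝ) := by positivity
  calc s * (av ⬝ᵥ (runB (isBlockUnion_fine hR') n a).toBlocks₁₁ *ᵥ av) ≤ s * ((L : ℝ) * (av ⬝ᵥ (runA n L a R') *ᵥ av)) :=
        mul_le_mul_of_nonneg_left h1 hs0
    _ = (L : ℝ) * (s * (av ⬝ᵥ (runA n L a R') *ᵥ av)) := by ring
    _ ≤ (L : ℝ) * (Sum.elim (Real.sqrt s • av) ((1 / (n : ℝ)) • ψ) ⬝ᵥ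
          (runB (isBlockUnion_fine hR') n a) *ᵥ (Sum.elim (Real.sqrt s • av) ((1 / (n : ℝ)) • ψ))) := mul_le_mul_of_nonneg_left h2 hL0

end Summit.QuantumFields.BalabanUV.T4Continuum.NE7K1LinWalkLineCoarseSharp

end
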